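import Summits.QuantumFields.YangMills.Theorems.UnitScaleTiltFluctuationComparisonRegPrGlobalSlackLegNaturalChartBirthAnalytic
import HarnessLib

/-!
# `UnitScaleTiltFluctuationComparisonRegPrGlobalSlackLegNaturalChartAnalyticTop` — THE TWO «DUMMY TOP» LETTERS OF THE NATURAL CHART FAMILY'S ANALYTICITY ROW ARE THEOREMS:
# (R2′) for `Φ♮[birthChartRows q, N]`, in the v4 door's own two-clause currency `ChartAnalyticΦ`, from EXACTLY two print-shaped letters — (ℓ) locality of the retained charts and
# (k) the (43) kernel budget (crux `FluctuationComparisonRegPrIntL`, stmt-QuantumFields-20520, STUB 3⁗χ(v4); cell `pub/ym-inputs`, seat ym-inputs-p11 (g3); count-neutral helper,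
# def-free, registry untouched)

WHY.  After ✓`chartAnalyticOwnΦ_rescaleW_naturalChart_rows_of_local` (this seat, g2) the own-indexed analyticity row of the leg-rescaled natural chart family
`rescaleΦw dist κ′ Φ♮[birthChartRows q, N]` at the rows datum `dataOfCoreRows q (canonPolymerRows q)` rests on THREE letters: (ℓ) locality, (k) the (43) kernel budget at the listed
blocks, and (t) a «dummy top clause» — the background row at the listed non-block point sets ABOVE the top (`K < k`), where the canonical polymerisation lists one dummy domain,
the whole torus, at term level `1` (✓`canonLocRows`).  And the transfer to the door's two-clause row of record ✓`chartAnalyticLegΦ_chiV4_of_own` (own ⟹ `ChartAnalyticΦ`) carries a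
SECOND dummy-top letter `hTop`: the REFINED chart of run `K+1` at `(b+1, refineSet Y)` above the top, outside `LocMatched`'s range.  Both letters were located (ym-inputs-p10, memo
v3) as wanting an upstream repair of the frozen binders.  FOR THE NATURAL CHART FAMILY NO REPAIR IS NEEDED — both are theorems of the tree's geometry and the record:

* `blockSet_ne_univ` (§1) — a block of level `i ≤ m + K` is never the whole torus (`sitesPerDir ≥ 2`: ✓`Params.one_lt_sitesPerDir`, ✓`coarsen_surjective`), so at the dummy domain
  `univ` the natural chart family reads its BACKGROUND family, the canonical birth charts.
* `blockSet_not_mem_canonLocRows_of_lt` (§1) — hence the kernel-budget letter (k) over the LISTED blocks has no dummy content: above the top no block is listed.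
* `birthChartRows_eq_zero_of_forall_ne`, `exists_dom_or_birthChartRows_eq_zero` (§2) — at ANY index the canonical birth chart is either `Ψ_X + Λ_X` of a retained step-`b` domain
  `X` with that point set (`b + 1 ≤ K`) or the ZERO chart.
* ★ **`chartAnalyticityAsCited_rescaleW_birthChartRows_of_local`** (§2) — hence, under the locality display (ℓ) ALONE, the leg-rescaled canonical birth chart family is
  `ChartAnalyticityAsCited … (𝔠.ρ·e^{−κ′R}) (C_A·e^{−κ·𝓛_K(1+b, Y)})` AT EVERY INDEX `(K, b, Y)` — listed or not, below or above the top (retained point set: THE RECORD's G3D-01/G3D-07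
  rows via ✓`chartAnalyticityAsCited_rescaleW_birthChartRows_domSet_of_local` and ✓`canonTreeLenRows_domSet`; elsewhere: the zero chart).  This is (t) and more.
* ★ **`chartAnalyticOwnΦ_rescaleW_naturalChart_rows_of_loc_ker`** (§3) — (R2′)-OWN for `rescaleΦw dist κ′ Φ♮` from (ℓ) + (k) only (✓p630833's split fed with §2).
* ★ **`chartAnalyticΦ_rescaleW_naturalChart_rows_of_own`** (§4) — own ⟹ the two-clause `ChartAnalyticΦ` FOR `Φ♮` with `hTop` DISCHARGED: above the top the refined index is
  `(K+1, 1, univ)` (✓`refineSet_univ`); `univ` is not a level-`2` block (§1); if a retained step-`1` domain of run `K+1` has point set `univ` the clause IS run `K+1`'s own listed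
  clause at lattice level `2` and ✓`treeLenRefinedOn_canonRows` (`𝓛_K(1, univ) ≤ 𝓛_{K+1}(2, univ)`, `κ ≥ 0`) matches the bound; otherwise the refined chart is the zero chart.
* ★★ **`chartAnalyticΦ_rescaleW_naturalChart_rows_of_loc_ker`** / **`…_chiV4_of_loc_ker`** (§4) — THE DOOR's (R2′) ROW for the natural chart family, letter for letter the third
  conjunct of ✓`k1aLegRowsDisplayChiAtLowV4_of_kernelRows`'s kernel-row display (`ChartAnalyticΦ (dataOfV4chi p (canonPolymerRows (toRows ∘ p))) (rescaleΦw (canonLegDist F) κ′ Φ♮) 𝔠.κ ρ C_A`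
  at `ρ := 𝔠.ρ·e^{−κ′R}`), FROM (ℓ) + (k) ALONE (`0 ≤ 𝔠.κ` by ✓`kappa_record_admissible`).
So the natural-object analyticity residue of 3⁗χ(v4)'s display is exactly two print-shaped letters: (ℓ) [Balaban1985UV3] p.263 L4 «𝒫(X,·) depends on U restricted to X̃» (a
HYPOTHESIS — `StepAlphaV3CoreAC` has no locality row today) and (k) [Balaban1985UV3] (43)/(45) (the definer's reading of the kernels' decay); no dummy clause remains.

HONEST SCOPE.  Case bookkeeping over the tree's torus geometry, the canonical polymerisation and two landed lemmas; (ℓ) and (k) stay HYPOTHESES; (43)-as-definition and the two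
one-family two-run rows (K)/(BC) are untouched (UNPRINTED for non-abelian d = 3); nothing of [Balaban1985UV3] / [King1986] asserted; no summit / rung / gap claim (YM₃ on T³ is
ladder rung R3, not the Clay problem).  L-floor: none (`1 ≤ m` only).

References: T. Bałaban, CMP 102 (1985) 255–275 [Balaban1985UV3] (p.263 L4, (24)–(25) p.262, (29)–(30) p.263, (43)–(45) pp.266–267, (59) p.270); T. Bałaban, CMP 109 (1987)
249–301 [Balaban1987RG1] ((0.1) p.251).
-/

set_option autoImplicit false

noncomputable section

open scoped BigOperators
open Finset Metric
open Literature.MathematicalPhysics.QuantumFieldTheory.Balaban1983to89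
open Literature.MathematicalPhysics.QuantumFieldTheory.Balaban1983to89.T3ContinuumYM3Torus
open Literature.MathematicalPhysics.QuantumFieldTheory.Balaban1983to89.T3AlphaInputsAC (AlphaDataT3)
open Literature.MathematicalPhysics.QuantumFieldTheory.Balaban1983to89.T3AlphaPolymerSocket
open Literature.MathematicalPhysics.QuantumFieldTheory.Balaban1983to89.TreeLengthTorus (tsys)
open Literature.MathematicalPhysics.QuantumFieldTheory.Balaban1985CMP102
open Literature.MathematicalPhysics.QuantumFieldTheory.Balaban1985CMP102.Setting
open Literature.MathematicalPhysics.QuantumFieldTheory.Balaban1985CMP102.Binders (ChartAnalyticityAsCited)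
open Summit.QuantumFields.Balaban3D.Carriers
open Summit.QuantumFields.Balaban3D.Proofs.Primitives
open Summit.QuantumFields.Balaban3D.Proofs.GroupModelLieC (lieC)
open Summit.QuantumFields.YangMills.Theorems
open Summit.QuantumFields.YangMills.Theorems.GlobalSlackKernelMatching
open Summit.QuantumFields.YangMills.Theorems.GlobalSlackCanonicalPolymers

namespace Summit.QuantumFields.YangMills.Theorems.GlobalSlackKernelLeg

/-! ## §1 Geometry: a block is never the whole torus; the zero chart; above the top only `univ` is listed -/

section Geometry

variable {F : T3Family}

/-- **A BLOCK OF LEVEL `i ≤ m + K` IS NEVER THE WHOLE FINE TORUS**: every direction of `T^{(i)}` has at least two sites (`sitesPerDir i = 2·L^{m+K−i} ≥ 2`), so a second level-`i`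
site exists and lies over some fine site (✓`coarsen_surjective`), which is outside the block. [cite: Balaban1987RG1, (0.1) p.251] -/
theorem blockSet_ne_univ (K i : ℕ) (hi : i ≤ F.m + K) (y : Site (F.P K) i) : blockSet K i y ≠ Set.univ := by
  intro huniv
  haveI : Fact (1 < (F.P K).sitesPerDir i) := ⟨(F.P K).one_lt_sitesPerDir i⟩
  set μ : Fin (F.P K).d := ⟨0, (F.P K).hd⟩
  have hne : Site.shift y μ ≠ y := by
    intro h
    have h1 : Function.update y μ (y μ + 1) μ = y μ := congrFun h μ
    rw [Function.update_self] at h1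
    exact one_ne_zero (add_eq_left.mp h1)
  obtain ⟨x, hx⟩ := coarsen_surjective i (show i ≤ (F.P K).m + (F.P K).K from hi) (Site.shift y μ)
  have hxy : x ∈ blockSet K i y := huniv ▸ Set.mem_univ x
  exact hne (hx.symm.trans hxy)

/-- The zero chart is `ChartAnalyticityAsCited` on every ball with every non-negative bound. [folklore] -/
theorem chartAnalyticityAsCited_zero {E : Type} [NormedAddCommGroup E] [NormedSpace ℂ E] {ρ M : ℝ} (hρ : 0 < ρ) (hM : 0 ≤ M) :
    ChartAnalyticityAsCited (0 : E → ℂ) ρ M :=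
  ⟨hρ, differentiableOn_const 0, fun z _ => by simpa using hM⟩

variable {𝕍 : Type} [NormedAddCommGroup 𝕍] [NormedSpace ℂ 𝕍]

/-- The leg-rescaling of a zero chart is the zero chart (`Φ̃ = Φ ∘ D_w`). [folklore] -/
theorem rescaleΦw_eq_zero_of_eq_zero (dist : LegDist F) (κ' : ℝ) (Φ : ChartFam 𝕍 F) {K b : ℕ} {Y : Set (Site (F.P K) 0)} (h : Φ K b Y = 0) :
    rescaleΦw dist κ' Φ K b Y = 0 := by
  funext z
  simp only [rescaleΦw, h, Pi.zero_apply]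

end Geometry

section Canon

variable {F : T3Family} {𝔠 : AlphaConsts F.L (suGroupModel 2).N} {γ : ℝ} {hγ : 0 < γ} {hγ1 : γ ≤ (min 𝔠.gamma0 1) ^ 2}
  (q : ∀ K, AlphaInputsT3AC.PkgCoreRows F 𝔠 γ hγ hγ1 K)

/-- **ABOVE THE TOP ONLY THE WHOLE TORUS IS LISTED, AT TERM LEVEL `1`**: for `K < k`, `Y ∈ canonLocRows q K k triv i` forces `i = 1` and `Y = univ`. [cite: Balaban1985UV3, (43) p.266, (59) p.270] -/
theorem eq_univ_of_mem_canonLocRows_of_lt {K k i : ℕ} (hk : K < k) {Y : Set (Site (F.P K) 0)} (hY : Y ∈ canonLocRows q K k (Hist.triv (F.P K) k) i) :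
    i = 1 ∧ Y = Set.univ := by
  classical
  cases k with
  | zero => omega
  | succ j =>
    have hj : ¬ j + 1 ≤ K := by omega
    by_cases hi : i = 1
    · simp only [canonLocRows, if_neg hj, if_pos hi, Finset.mem_singleton] at hY
      exact ⟨hi, hY⟩
    · simp only [canonLocRows, if_neg hj, if_neg hi] at hY
      simp at hY

/-- **A RETAINED DOMAIN'S POINT SET IS LISTED** at the new level: for `b + 1 ≤ K` and `X ∈ newDomsRows q K b triv`, `domSet X ∈ canonLocRows q K (b+1) triv (1+b)`. [cite: Balaban1985UV3, (43) p.266, (59) p.270] -/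
theorem domSet_mem_canonLocRows {K b : ℕ} (hb : b + 1 ≤ K) {X : (tsys 3 (nblkOf (SK F 𝔠 γ hγ hγ1 K) 𝔠.lane.carrier b)).Dom}
    (hX : X ∈ newDomsRows q K b (Hist.triv (F.P K) (b + 1))) :
    domSet (F := F) 𝔠.lane.carrier.M₁ K b X ∈ canonLocRows q K (b + 1) (Hist.triv (F.P K) (b + 1)) (1 + b) := by
  classical
  simp only [canonLocRows, if_pos hb, if_pos (show 1 + b = b + 1 by omega), Finset.mem_image]
  exact ⟨X, hX, rfl⟩

/-- **THE KERNEL BUDGET LETTER (k) HAS NO DUMMY CONTENT**: above the top (`K < k`) no block is listed — the only listed set is `univ`, which is not a block of level `1 + b ≤ m + K`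
(`blockSet_ne_univ`); so a hypothesis over the listed blocks `blockSet K (1+b) y ∈ canonLocRows q K k triv (1+b)` speaks of print's old blocks below the top only. [cite: Balaban1985UV3, (43) p.266] -/
theorem blockSet_not_mem_canonLocRows_of_lt {K k b : ℕ} (hk : K < k) (y : Site (F.P K) (1 + b)) :
    blockSet K (1 + b) y ∉ canonLocRows q K k (Hist.triv (F.P K) k) (1 + b) := by
  intro hY
  obtain ⟨hi, hu⟩ := eq_univ_of_mem_canonLocRows_of_lt q hk hY
  have hm := F.hm
  exact blockSet_ne_univ K (1 + b) (by omega) y hu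

end Canon

/-! ## §2 The canonical birth chart family: a retained domain's `Ψ_X + Λ_X`, or the zero chart — analytic at every index under locality -/

section Birth

variable {F : T3Family} {𝔠 : AlphaConsts F.L (suGroupModel 2).N} {γ : ℝ} {hγ : 0 < γ} {hγ1 : γ ≤ (min 𝔠.gamma0 1) ^ 2}
  (q : ∀ K, AlphaInputsT3AC.PkgCoreRows F 𝔠 γ hγ hγ1 K)

open Classical in
/-- **OFF THE RETAINED POINT SETS THE CANONICAL BIRTH CHART IS THE ZERO CHART**: if no retained step-`b` domain of run `K` (trivial history) has point set `Y`, then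
`birthChartRows q K b Y = 0` (below the top the sum over `birthDomsRows` is empty; above it the family is `0` by definition). [cite: Balaban1985UV3, (33) p.264, (59) p.270] -/
theorem birthChartRows_eq_zero_of_forall_ne (K b : ℕ) (Y : Set (Site (F.P K) 0))
    (h : ∀ X ∈ newDomsRows q K b (Hist.triv (F.P K) (b + 1)), domSet (F := F) 𝔠.lane.carrier.M₁ K b X ≠ Y) : birthChartRows q K b Y = 0 := by
  classical
  unfold birthChartRows
  split_ifs with hb
  · have hempty : birthDomsRows q K b Y = ∅ := by
      simp only [birthDomsRows, Finset.filter_eq_empty_iff]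
      exact fun X hX => h X hX
    funext x
    simp [hempty]
  · rfl

/-- **THE DICHOTOMY**: at any index `(K, b, Y)` either a retained step-`b` domain `X` of run `K` has point set `Y` and `b + 1 ≤ K`, or `birthChartRows q K b Y = 0`. [cite: Balaban1985UV3, (33) p.264, (59) p.270] -/
theorem exists_dom_or_birthChartRows_eq_zero (K b : ℕ) (Y : Set (Site (F.P K) 0)) :
    (∃ X ∈ newDomsRows q K b (Hist.triv (F.P K) (b + 1)), domSet (F := F) 𝔠.lane.carrier.M₁ K b X = Y ∧ b + 1 ≤ K) ∨ birthChartRows q K b Y = 0 := by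
  classical
  by_cases hb : b + 1 ≤ K
  · by_cases hX : ∃ X ∈ newDomsRows q K b (Hist.triv (F.P K) (b + 1)), domSet (F := F) 𝔠.lane.carrier.M₁ K b X = Y
    · obtain ⟨X, hX, hXY⟩ := hX
      exact Or.inl ⟨X, hX, hXY, hb⟩
    · exact Or.inr (birthChartRows_eq_zero_of_forall_ne q K b Y fun X hXm hXY => hX ⟨X, hXm, hXY⟩)
  · right
    unfold birthChartRows
    rw [if_neg hb]

/-- ★ **UNDER THE LOCALITY DISPLAY THE LEG-RESCALED CANONICAL BIRTH CHART FAMILY IS ANALYTIC AT EVERY INDEX, WITH THE CANONICAL BOUND**: if every retained step-`b` chart `Ψ_X`, `Λ_X`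
(`b + 1 ≤ K`) reads only the legs `c` with `dist K b (domSet X) c ≤ R` (print p.263 L4 — a HYPOTHESIS), then for `κ′ ≥ 0`, `κ ≤ 𝔠.κ`, `C25 + C63 ≤ C_A` and EVERY `(K, b, Y)`:
`ChartAnalyticityAsCited (rescaleΦw dist κ′ (birthChartRows q) K b Y) (𝔠.ρ·e^{−κ′R}) (C_A·e^{−κ·𝓛_K(1+b, Y)})` — at a retained point set by THE RECORD (G3D-01 + G3D-07 via
✓`chartAnalyticityAsCited_rescaleW_birthChartRows_domSet_of_local`, `𝓛_K(1+b, domSet X) = dj X` by ✓`canonTreeLenRows_domSet`), elsewhere (in particular at the dummy whole-torus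
domain above the top when no step-`0` domain covers the torus) by the zero chart. [cite: Balaban1985UV3, p.263 L4, (24)-(25) p.262, (29)-(30) p.263, (33) p.264, (45) p.267] -/
theorem chartAnalyticityAsCited_rescaleW_birthChartRows_of_local (dist : LegDist F) {κ' R κ C_A : ℝ} (hκ' : 0 ≤ κ') (hκ : κ ≤ 𝔠.κ)
    (hCA : 𝔠.C25 + 𝔠.C63 ≤ C_A)
    (hloc : ∀ (K b : ℕ), b + 1 ≤ K → ∀ X ∈ newDomsRows q K b (Hist.triv (F.P K) (b + 1)), ∀ z : PBond (F.P K) b → ↥(lieC (suGroupModel 2)),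
      ((q K).𝔖 b).Ψ X z = ((q K).𝔖 b).Ψ X (fun c => if dist K b (domSet (F := F) 𝔠.lane.carrier.M₁ K b X) c ≤ R then z c else 0) ∧
      ((q K).𝔄.Λc b).Ψ X z = ((q K).𝔄.Λc b).Ψ X (fun c => if dist K b (domSet (F := F) 𝔠.lane.carrier.M₁ K b X) c ≤ R then z c else 0))
    (K b : ℕ) (Y : Set (Site (F.P K) 0)) :
    ChartAnalyticityAsCited (rescaleΦw dist κ' (birthChartRows q) K b Y) (𝔠.ρ * Real.exp (-(κ' * R)))
      (C_A * Real.exp (-κ * (AlphaInputsT3AC.dataOfCoreRows q (canonPolymerRows q)).treeLen K (1 + b) Y)) := by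
  classical
  have hρ' : 0 < 𝔠.ρ * Real.exp (-(κ' * R)) := mul_pos 𝔠.ρ_pos (Real.exp_pos _)
  have hC0 : 0 ≤ 𝔠.C25 + 𝔠.C63 := add_nonneg 𝔠.C25_nonneg 𝔠.C63_nonneg
  have hCA0 : 0 ≤ C_A := hC0.trans hCA
  rcases exists_dom_or_birthChartRows_eq_zero q K b Y with ⟨X, hX, rfl, hb⟩ | h0
  · -- the retained domain's `Ψ_X + Λ_X`: analytic from the record, bound matched by the canonical tree length
    have hbm : b ≤ F.m + K := by have := F.hm; omega
    have h := chartAnalyticityAsCited_rescaleW_birthChartRows_domSet_of_local q dist hκ' K b hb X hX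
      (fun z => (hloc K b hb X hX z).1) (fun z => (hloc K b hb X hX z).2)
    refine chartAnalyticityAsCited_mono h ?_
    have htl : (AlphaInputsT3AC.dataOfCoreRows q (canonPolymerRows q)).treeLen K (1 + b) (domSet (F := F) 𝔠.lane.carrier.M₁ K b X) =
        (tsys 3 (nblkOf (SK F 𝔠 γ hγ hγ1 K) 𝔠.lane.carrier b)).dj X := by
      rw [show 1 + b = b + 1 by omega]
      exact canonTreeLenRows_domSet q K b hbm X
    rw [htl]
    have hdj : 0 ≤ (tsys 3 (nblkOf (SK F 𝔠 γ hγ hγ1 K) 𝔠.lane.carrier b)).dj X := by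
      have h0 := canonTreeLenRows_nonneg q K (b + 1) (domSet (F := F) 𝔠.lane.carrier.M₁ K b X)
      rwa [canonTreeLenRows_domSet q K b hbm X] at h0
    have hexp : Real.exp (-(𝔠.κ * (tsys 3 (nblkOf (SK F 𝔠 γ hγ hγ1 K) 𝔠.lane.carrier b)).dj X)) ≤
        Real.exp (-κ * (tsys 3 (nblkOf (SK F 𝔠 γ hγ hγ1 K) 𝔠.lane.carrier b)).dj X) := Real.exp_le_exp.mpr (by nlinarith)
    calc (𝔠.C25 + 𝔠.C63) * Real.exp (-(𝔠.κ * (tsys 3 (nblkOf (SK F 𝔠 γ hγ hγ1 K) 𝔠.lane.carrier b)).dj X))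
        ≤ (𝔠.C25 + 𝔠.C63) * Real.exp (-κ * (tsys 3 (nblkOf (SK F 𝔠 γ hγ hγ1 K) 𝔠.lane.carrier b)).dj X) := mul_le_mul_of_nonneg_left hexp hC0
      _ ≤ C_A * Real.exp (-κ * (tsys 3 (nblkOf (SK F 𝔠 γ hγ hγ1 K) 𝔠.lane.carrier b)).dj X) := mul_le_mul_of_nonneg_right hCA (Real.exp_pos _).le
  · -- the zero chart
    rw [rescaleΦw_eq_zero_of_eq_zero dist κ' (birthChartRows q) h0]
    exact chartAnalyticityAsCited_zero hρ' (mul_nonneg hCA0 (Real.exp_pos _).le)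

end Birth

/-! ## §3 (R2′)-own for the leg-rescaled natural chart family from locality and the kernel budget only -/

section Own

open scoped Nat
variable {F : T3Family} {𝔠 : AlphaConsts F.L (suGroupModel 2).N} {γ : ℝ} {hγ : 0 < γ} {hγ1 : γ ≤ (min 𝔠.gamma0 1) ^ 2}
  (q : ∀ K, AlphaInputsT3AC.PkgCoreRows F 𝔠 γ hγ hγ1 K)
  (N : (K b : ℕ) → Site (F.P K) (1 + b) → (n : ℕ) → (Fin n → PBond (F.P K) b) → ContinuousMultilinearMap ℂ (fun _ : Fin n => ↥(lieC (suGroupModel 2))) ℂ)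

open Classical in
/-- ★ **(R2′)-OWN FOR `rescaleΦw dist κ′ Φ♮[birthChartRows q, N]` AT THE ROWS DATUM FROM EXACTLY TWO LETTERS**: (ℓ) LOCALITY of the retained charts (print p.263 L4; a hypothesis) and
(k) THE (43) KERNEL BUDGET at every listed block at the shrunk radius `𝔠.ρ·e^{−κ′R}` — with `κ′ ≥ 0`, `κ ≤ 𝔠.κ`, `C25 + C63 ≤ C_A`.  (✓`chartAnalyticOwnΦ_rescaleW_naturalChart_rows` with
its background half supplied AT EVERY LISTED NON-BLOCK POINT SET — below and above the top — by `chartAnalyticityAsCited_rescaleW_birthChartRows_of_local`; the dummy top clause of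
✓`chartAnalyticOwnΦ_rescaleW_naturalChart_rows_of_local` is gone.) [cite: Balaban1985UV3, p.263 L4, (25) p.262, (29)-(30) p.263, (43) p.266, (45) p.267] -/
theorem chartAnalyticOwnΦ_rescaleW_naturalChart_rows_of_loc_ker (dist : LegDist F) {κ' R κ C_A : ℝ} (hκ' : 0 ≤ κ') (hκ : κ ≤ 𝔠.κ)
    (hCA : 𝔠.C25 + 𝔠.C63 ≤ C_A)
    (hloc : ∀ (K b : ℕ), b + 1 ≤ K → ∀ X ∈ newDomsRows q K b (Hist.triv (F.P K) (b + 1)), ∀ z : PBond (F.P K) b → ↥(lieC (suGroupModel 2)),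
      ((q K).𝔖 b).Ψ X z = ((q K).𝔖 b).Ψ X (fun c => if dist K b (domSet (F := F) 𝔠.lane.carrier.M₁ K b X) c ≤ R then z c else 0) ∧
      ((q K).𝔄.Λc b).Ψ X z = ((q K).𝔄.Λc b).Ψ X (fun c => if dist K b (domSet (F := F) 𝔠.lane.carrier.M₁ K b X) c ≤ R then z c else 0))
    (hker : ∀ (K k b : ℕ) (y : Site (F.P K) (1 + b)), blockSet K (1 + b) y ∈ canonLocRows q K k (Hist.triv (F.P K) k) (1 + b) →
      ∑ n ∈ Finset.Ico 2 7, ((n ! : ℝ))⁻¹ * ∑ c : Fin n → PBond (F.P K) b,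
        ‖N K b y n c‖ * (∏ i, Real.exp (κ' * dist K b (blockSet K (1 + b) y) (c i))) * (𝔠.ρ * Real.exp (-(κ' * R)) / 2) ^ n ≤
          C_A * Real.exp (-κ * (AlphaInputsT3AC.dataOfCoreRows q (canonPolymerRows q)).treeLen K (1 + b) (blockSet K (1 + b) y))) :
    ChartAnalyticOwnΦ (AlphaInputsT3AC.dataOfCoreRows q (canonPolymerRows q)) (rescaleΦw dist κ' (fun K b Y =>
        if h : ∃ y : Site (F.P K) (1 + b), blockSet K (1 + b) y = Y then
          (fun x : PBond (F.P K) b → ↥(lieC (suGroupModel 2)) =>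
            ∑ n ∈ Finset.Ico 2 7, ((n ! : ℂ))⁻¹ * ∑ c : Fin n → PBond (F.P K) b, N K b h.choose n c (fun i => x (c i)))
        else birthChartRows q K b Y)) κ (𝔠.ρ * Real.exp (-(κ' * R))) C_A :=
  chartAnalyticOwnΦ_rescaleW_naturalChart_rows q N dist (mul_pos 𝔠.ρ_pos (Real.exp_pos _))
    (fun K _ b Y _ _ => chartAnalyticityAsCited_rescaleW_birthChartRows_of_local q dist hκ' hκ hCA hloc K b Y) hker

end Own

/-! ## §4 Own ⟹ the door's two-clause row for the natural chart family (the refined dummy-top letter discharged); the door's (R2′) row from (ℓ) + (k) -/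

section Door

open scoped Nat
variable {F : T3Family} {𝔠 : AlphaConsts F.L (suGroupModel 2).N} {γ : ℝ} {hγ : 0 < γ} {hγ1 : γ ≤ (min 𝔠.gamma0 1) ^ 2}
  (q : ∀ K, AlphaInputsT3AC.PkgCoreRows F 𝔠 γ hγ hγ1 K)
  (N : (K b : ℕ) → Site (F.P K) (1 + b) → (n : ℕ) → (Fin n → PBond (F.P K) b) → ContinuousMultilinearMap ℂ (fun _ : Fin n => ↥(lieC (suGroupModel 2))) ℂ)

open Classical in
/-- ★ **OWN ⟹ THE TWO-CLAUSE ROW OF RECORD, FOR THE LEG-RESCALED NATURAL CHART FAMILY, WITH THE REFINED DUMMY-TOP LETTER DISCHARGED** (`κ ≥ 0`, `C_A ≥ 0`, `ρ > 0`): below the top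
✓`refineSet_mem_canonLocRows` (run `K`'s listed domains refine to run `K+1`'s, `𝓛` non-decreasing); above the top (`K < k`) the listed set is `univ` at `b = 0`
(`eq_univ_of_mem_canonLocRows_of_lt`), the refined index is `(K+1, 1, univ)` (✓`refineSet_univ`), `univ` is not a level-`2` block (`blockSet_ne_univ`, `2 ≤ m + K + 1`), so the
natural chart there is the canonical birth chart: EITHER a retained step-`1` domain of run `K+1` has point set `univ` — then `univ` is LISTED in run `K+1` at lattice level `2`
(`domSet_mem_canonLocRows`), the clause is run `K+1`'s OWN clause, and ✓`treeLenRefinedOn_canonRows` + `κ ≥ 0` turn its bound `C_A e^{−κ𝓛_{K+1}(2, univ)}` into `C_A e^{−κ𝓛_K(1, univ)}` —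
OR the refined chart is the zero chart (`exists_dom_or_birthChartRows_eq_zero`). [cite: Balaban1985UV3, (24)-(25) p.262, (29)-(30) p.263, (33) p.264, (43) p.266; Balaban1987RG1, (0.1) p.251] -/
theorem chartAnalyticΦ_rescaleW_naturalChart_rows_of_own (dist : LegDist F) (κ' : ℝ) {κ ρ C_A : ℝ} (hκ : 0 ≤ κ) (hCA : 0 ≤ C_A) (hρ : 0 < ρ)
    (h : ChartAnalyticOwnΦ (AlphaInputsT3AC.dataOfCoreRows q (canonPolymerRows q)) (rescaleΦw dist κ' (fun K b Y =>
        if h : ∃ y : Site (F.P K) (1 + b), blockSet K (1 + b) y = Y then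
          (fun x : PBond (F.P K) b → ↥(lieC (suGroupModel 2)) =>
            ∑ n ∈ Finset.Ico 2 7, ((n ! : ℂ))⁻¹ * ∑ c : Fin n → PBond (F.P K) b, N K b h.choose n c (fun i => x (c i)))
        else birthChartRows q K b Y)) κ ρ C_A) :
    ChartAnalyticΦ (AlphaInputsT3AC.dataOfCoreRows q (canonPolymerRows q)) (rescaleΦw dist κ' (fun K b Y =>
        if h : ∃ y : Site (F.P K) (1 + b), blockSet K (1 + b) y = Y then
          (fun x : PBond (F.P K) b → ↥(lieC (suGroupModel 2)) =>
            ∑ n ∈ Finset.Ico 2 7, ((n ! : ℂ))⁻¹ * ∑ c : Fin n → PBond (F.P K) b, N K b h.choose n c (fun i => x (c i)))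
        else birthChartRows q K b Y)) κ ρ C_A := by
  classical
  refine chartAnalyticΦ_of_own (fun K k b Y hY => ?_) (treeLenRefinedOn_canonRows q) hκ hCA h
  by_cases hk : k ≤ K
  · exact Or.inl (refineSet_mem_canonLocRows q hk hY)
  · right
    have hlt : K < k := by omega
    have hT := treeLenRefinedOn_canonRows q K k b Y hY
    obtain ⟨hi, rfl⟩ := eq_univ_of_mem_canonLocRows_of_lt q hlt hY
    have hb : b = 0 := by omega
    subst hb
    rw [refineSet_univ] at hT ⊢
    -- `univ` is not a level-`2` block of run `K+1`: the natural chart there is the canonical birth chart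
    have hm := F.hm
    have hnb : ∀ y : Site (F.P (K + 1)) (1 + (0 + 1)), blockSet (K + 1) (1 + (0 + 1)) y ≠ (Set.univ : Set (Site (F.P (K + 1)) 0)) :=
      fun y => blockSet_ne_univ (K + 1) (1 + (0 + 1)) (by omega) y
    rcases exists_dom_or_birthChartRows_eq_zero q (K + 1) (0 + 1) Set.univ with ⟨X, hX, hXu, hbK⟩ | h0
    · -- run `K+1`'s own listed clause at lattice level `2`, bound matched by `𝓛_K(1, univ) ≤ 𝓛_{K+1}(2, univ)`
      have hmem : (Set.univ : Set (Site (F.P (K + 1)) 0)) ∈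
          canonLocRows q (K + 1) (0 + 1 + 1) (Hist.triv (F.P (K + 1)) (0 + 1 + 1)) (1 + (0 + 1)) := by
        rw [← hXu]
        exact domSet_mem_canonLocRows q hbK hX
      refine chartAnalyticityAsCited_mono (h (K + 1) (0 + 1 + 1) (0 + 1) Set.univ hmem) ?_
      exact mul_le_mul_of_nonneg_left (Real.exp_le_exp.mpr (by nlinarith)) hCA
    · -- the zero chart
      have hfun : rescaleΦw dist κ' (fun K b Y =>
          if h : ∃ y : Site (F.P K) (1 + b), blockSet K (1 + b) y = Y then
            (fun x : PBond (F.P K) b → ↥(lieC (suGroupModel 2)) =>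
              ∑ n ∈ Finset.Ico 2 7, ((n ! : ℂ))⁻¹ * ∑ c : Fin n → PBond (F.P K) b, N K b h.choose n c (fun i => x (c i)))
          else birthChartRows q K b Y) (K + 1) (0 + 1) Set.univ = rescaleΦw dist κ' (birthChartRows q) (K + 1) (0 + 1) Set.univ := by
        funext z
        exact congrFun (naturalChart_of_forall_ne (birthChartRows q) N hnb) (legD ↥(lieC (suGroupModel 2)) dist κ' (K + 1) (0 + 1) Set.univ z)
      rw [hfun, rescaleΦw_eq_zero_of_eq_zero dist κ' (birthChartRows q) h0]
      exact chartAnalyticityAsCited_zero hρ (mul_nonneg hCA (Real.exp_pos _).le)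

open Classical in
/-- ★★ **THE DOOR's (R2′) ROW FOR THE NATURAL CHART FAMILY FROM (ℓ) + (k) ALONE** (rows datum; any leg distance; `κ′ ≥ 0`, `0 ≤ κ ≤ 𝔠.κ`, `C25 + C63 ≤ C_A`):
`ChartAnalyticΦ (dataOfCoreRows q (canonPolymerRows q)) (rescaleΦw dist κ′ Φ♮[birthChartRows q, N]) κ (𝔠.ρ·e^{−κ′R}) C_A` — §3 then §4's transfer; no dummy clause left.
[cite: Balaban1985UV3, p.263 L4, (24)-(25) p.262, (29)-(30) p.263, (43) p.266, (45) p.267; Balaban1987RG1, (0.1) p.251] -/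
theorem chartAnalyticΦ_rescaleW_naturalChart_rows_of_loc_ker (dist : LegDist F) {κ' R κ C_A : ℝ} (hκ' : 0 ≤ κ') (hκ0 : 0 ≤ κ) (hκ : κ ≤ 𝔠.κ)
    (hCA : 𝔠.C25 + 𝔠.C63 ≤ C_A)
    (hloc : ∀ (K b : ℕ), b + 1 ≤ K → ∀ X ∈ newDomsRows q K b (Hist.triv (F.P K) (b + 1)), ∀ z : PBond (F.P K) b → ↥(lieC (suGroupModel 2)),
      ((q K).𝔖 b).Ψ X z = ((q K).𝔖 b).Ψ X (fun c => if dist K b (domSet (F := F) 𝔠.lane.carrier.M₁ K b X) c ≤ R then z c else 0) ∧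
      ((q K).𝔄.Λc b).Ψ X z = ((q K).𝔄.Λc b).Ψ X (fun c => if dist K b (domSet (F := F) 𝔠.lane.carrier.M₁ K b X) c ≤ R then z c else 0))
    (hker : ∀ (K k b : ℕ) (y : Site (F.P K) (1 + b)), blockSet K (1 + b) y ∈ canonLocRows q K k (Hist.triv (F.P K) k) (1 + b) →
      ∑ n ∈ Finset.Ico 2 7, ((n ! : ℝ))⁻¹ * ∑ c : Fin n → PBond (F.P K) b,
        ‖N K b y n c‖ * (∏ i, Real.exp (κ' * dist K b (blockSet K (1 + b) y) (c i))) * (𝔠.ρ * Real.exp (-(κ' * R)) / 2) ^ n ≤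
          C_A * Real.exp (-κ * (AlphaInputsT3AC.dataOfCoreRows q (canonPolymerRows q)).treeLen K (1 + b) (blockSet K (1 + b) y))) :
    ChartAnalyticΦ (AlphaInputsT3AC.dataOfCoreRows q (canonPolymerRows q)) (rescaleΦw dist κ' (fun K b Y =>
        if h : ∃ y : Site (F.P K) (1 + b), blockSet K (1 + b) y = Y then
          (fun x : PBond (F.P K) b → ↥(lieC (suGroupModel 2)) =>
            ∑ n ∈ Finset.Ico 2 7, ((n ! : ℂ))⁻¹ * ∑ c : Fin n → PBond (F.P K) b, N K b h.choose n c (fun i => x (c i)))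
        else birthChartRows q K b Y)) κ (𝔠.ρ * Real.exp (-(κ' * R))) C_A :=
  chartAnalyticΦ_rescaleW_naturalChart_rows_of_own q N dist κ' hκ0 ((add_nonneg 𝔠.C25_nonneg 𝔠.C63_nonneg).trans hCA)
    (mul_pos 𝔠.ρ_pos (Real.exp_pos _)) (chartAnalyticOwnΦ_rescaleW_naturalChart_rows_of_loc_ker q N dist hκ' hκ hCA hloc hker)

open Classical in
/-- ★★ **THE SAME AT THE v4 χ-PACKAGE — LETTER FOR LETTER THE (R2′) CONJUNCT OF ✓`k1aLegRowsDisplayChiAtLowV4_of_kernelRows`'s DISPLAY** (`q := fun K ↦ (p K).toRows`, datum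
`dataOfV4chi p (canonPolymerRows …)`, canonical leg distance, decay `𝔠.κ`, radius `ρ := 𝔠.ρ·e^{−κ′R}`): from (ℓ) locality of the retained charts (uniform collar `R`) and (k) the (43) kernel
budget at the listed blocks — nothing else. [cite: Balaban1985UV3, p.263 L4, (24)-(25) p.262, (29)-(30) p.263, (43) p.266, (45) p.267; Balaban1987RG1, (0.1) p.251] -/
theorem chartAnalyticΦ_rescaleW_naturalChart_chiV4_of_loc_ker (p : ∀ K, AlphaInputsT3AC.PkgAtV4Chi F 𝔠 γ hγ hγ1 K)
    (N : (K b : ℕ) → Site (F.P K) (1 + b) → (n : ℕ) → (Fin n → PBond (F.P K) b) → ContinuousMultilinearMap ℂ (fun _ : Fin n => ↥(lieC (suGroupModel 2))) ℂ)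
    {κ' R C_A : ℝ} (hκ' : 0 ≤ κ') (hCA : 𝔠.C25 + 𝔠.C63 ≤ C_A)
    (hloc : ∀ (K b : ℕ), b + 1 ≤ K → ∀ X ∈ newDomsRows (fun K => (p K).toRows) K b (Hist.triv (F.P K) (b + 1)), ∀ z : PBond (F.P K) b → ↥(lieC (suGroupModel 2)),
      (((p K).toRows).𝔖 b).Ψ X z = (((p K).toRows).𝔖 b).Ψ X (fun c => if canonLegDist F K b (domSet (F := F) 𝔠.lane.carrier.M₁ K b X) c ≤ R then z c else 0) ∧
      (((p K).toRows).𝔄.Λc b).Ψ X z = (((p K).toRows).𝔄.Λc b).Ψ X (fun c => if canonLegDist F K b (domSet (F := F) 𝔠.lane.carrier.M₁ K b X) c ≤ R then z c else 0))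
    (hker : ∀ (K k b : ℕ) (y : Site (F.P K) (1 + b)), blockSet K (1 + b) y ∈ canonLocRows (fun K => (p K).toRows) K k (Hist.triv (F.P K) k) (1 + b) →
      ∑ n ∈ Finset.Ico 2 7, ((n ! : ℝ))⁻¹ * ∑ c : Fin n → PBond (F.P K) b,
        ‖N K b y n c‖ * (∏ i, Real.exp (κ' * canonLegDist F K b (blockSet K (1 + b) y) (c i))) * (𝔠.ρ * Real.exp (-(κ' * R)) / 2) ^ n ≤
          C_A * Real.exp (-𝔠.κ * (AlphaInputsT3AC.dataOfV4chi p (canonPolymerRows fun K => (p K).toRows)).treeLen K (1 + b) (blockSet K (1 + b) y))) :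
    ChartAnalyticΦ (AlphaInputsT3AC.dataOfV4chi p (canonPolymerRows fun K => (p K).toRows))
      (rescaleΦw (canonLegDist F) κ' fun K b Y =>
        if h : ∃ y : Site (F.P K) (1 + b), blockSet K (1 + b) y = Y then
          (fun x : PBond (F.P K) b → ↥(lieC (suGroupModel 2)) =>
            ∑ n ∈ Finset.Ico 2 7, ((n ! : ℂ))⁻¹ * ∑ c : Fin n → PBond (F.P K) b, N K b h.choose n c (fun i => x (c i)))
        else birthChartRows (fun K => (p K).toRows) K b Y) 𝔠.κ (𝔠.ρ * Real.exp (-(κ' * R))) C_A :=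
  chartAnalyticΦ_rescaleW_naturalChart_rows_of_loc_ker (fun K => (p K).toRows) N (canonLegDist F) hκ' (kappa_record_admissible 𝔠).1.le le_rfl hCA hloc hker

end Door

end Summit.QuantumFields.YangMills.Theorems.GlobalSlackKernelLeg

end
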